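import Mathlib.Analysis.Asymptotics.Defs
import Mathlib.Analysis.SpecialFunctions.Pow.Real
import Mathlib.Computability.Language
import Mathlib.Logic.Equiv.Bool
import Mathlib.Order.Filter.AtTopBot.Defs
import Literature.Computability.Complexity.TimeBounds
import Literature.Computability.Complexity.TimeBoundsComplProofs
import Literature.Computability.Complexity.BoolEncodings
import HarnessLib

-- provenance: harness21/H21/H21/Prelude/CplxCore/Classes.lean @ 7fd1621 (interim HEAD d8f2665); M5 mechanical rewrite
/-!
# Complexity core: deterministic time classes

Trunk `CplxCore`, concept C3 (`Classes`): the deterministic time complexity classes as sets of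
languages over Cook's alphabet `{0,1}`, i.e. `Set (Language Bool)`, strings being encoded by
the identity `id : List Bool → List Bool` (outline D2).

* `TimeClass t` — languages decidable in *exactly* `t n` steps (Cook-style primitive);
* `DTIME t` — big-O closure in the arithmetic form `∃ c, TimeClass (fun n => c * t n + c)`
  (no reals in the core definitions; `mem_DTIME_of_isBigO` records the link with Mathlib's
  `Asymptotics.IsBigO` at `Filter.atTop`);
* `P`, `E`, `EXP`, `SUBEXP`, and the function classes `FTIME t`, `FP`;
* class operators `co C` (complements) and `io C` (infinitely-often agreement);
* `IsTimeConstructible t` (Sipser's binary-output form).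

Mathlib has no complexity classes (searched: `DTIME`, `TimeClass`, `TimeConstructible`,
`PolyTime` — only the bundled machines `Turing.TM2ComputableInTime`,
`Turing.TM2ComputableInPolyTime` of `Mathlib/Computability/TuringMachine/Computable.lean`, wrapped in
`Literature.Prelude.CplxCore.TimeBounds`). We reuse `Computability.unaryEncodeNat`,
`Computability.encodeNat`, `Asymptotics.IsBigO`, `Filter.atTop`, `Filter.Frequently`,
`Nat.ceil`, `Real.rpow`.

## Design notes

* Class names are the customary acronyms (`P`, `E`, `EXP`, `SUBEXP`, `FP`, `DTIME`, `FTIME`),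
  always inside `namespace Literature.CplxCore` (outline D7, documented deviation from lowerCamelCase).
* Halting rule (outline D1): a TM2 machine must consume its whole input before halting, so
  `TimeClass t = ∅` whenever `t` is sublinear; harmless for all target statements.
* `SUBEXP = ⋂_{ε>0} DTIME(2^{n^ε})` is realised with `ε = 1/k`, `k ≥ 1` (cofinal, hence the same
  intersection by `DTIME_mono`), using `Real.rpow` and `Nat.ceil`.
* All definitions mentioning `TimeDecidable` (hence `Set.boolIndicator`) are `noncomputable`.

## References

* S. Arora, B. Barak, *Computational Complexity: A Modern Approach*, CUP 2009, Def. 1.12–1.13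
  (DTIME, P), §2.6 (EXP, E), Def. 2.19–2.20 (coNP, `co`), §20.1 (SUBEXP, i.o. simulation),
  §1.3 and §3.1 (time-constructible functions).
* M. Sipser, *Introduction to the Theory of Computation*, 3rd ed., Def. 7.7 (TIME), Def. 7.12 (P),
  Def. 9.8 (time constructible).
* J. Hartmanis, R. Stearns, *On the computational complexity of algorithms*, Trans. AMS 117
  (1965) (real-time countable functions).
-/

namespace Literature.Computability.Complexity

open _root_.Computability Filter Asymptotics

/-! ### Exact and big-O time classes -/

/-- `TimeClass t`: the languages `L ⊆ {0,1}*` decided by some TM2 machine within *exactly*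
`t n` steps on every input of length `n` (input encoded by `id`, answer by `encodeBool`).
This is the Cook-style exact-bound primitive; `DTIME t` is its big-O closure.
By the halting rule (a machine must pop its whole input stack before reaching `haltList`),
`TimeClass t = ∅` for sublinear `t`. Noncomputable (`Set.boolIndicator`).
[Sipser, Def. 7.7 (TIME(t(n))); Arora–Barak 2009, Def. 1.13] [cite: AroraBarak2009, Def. 1.13] -/
noncomputable def TimeClass (t : ℕ → ℕ) : Set (Language Bool) :=
  {L | TimeDecidable id L t}

/-- `DTIME t`: languages decidable in deterministic time `O(t n)`, in the arithmetic form
`∃ c, L ∈ TimeClass (fun n => c * t n + c)` (equivalent to the `IsBigO` form for the classes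
used here; see `mem_DTIME_of_isBigO`). [Arora–Barak 2009, Def. 1.12 (DTIME); Sipser, Def. 7.7] [cite: AroraBarak2009, Def. 1.12 (DTIME] -/
noncomputable def DTIME (t : ℕ → ℕ) : Set (Language Bool) :=
  {L | ∃ c : ℕ, L ∈ TimeClass (fun n => c * t n + c)}

/-- The class `P = ⋃ₖ DTIME(nᵏ)` of languages decidable in deterministic polynomial time.
[Arora–Barak 2009, Def. 1.13; Sipser, Def. 7.12] [cite: AroraBarak2009, Def. 1.13] -/
noncomputable def Classes.P : Set (Language Bool) :=
  ⋃ k : ℕ, DTIME (fun n => n ^ k)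

/-- The class `E = ⋃_c DTIME(2^{c n})` of languages decidable in linear-exponential time.
[Arora–Barak 2009, §2.6.2 (footnote, class E); Impagliazzo–Wigderson 1997] [cite: AroraBarak2009, §2.6.2 (footnote  class E] -/
noncomputable def E : Set (Language Bool) :=
  ⋃ c : ℕ, DTIME (fun n => 2 ^ (c * n))

/-- The class `EXP = ⋃ₖ DTIME(2^{nᵏ})` of languages decidable in exponential time.
[Arora–Barak 2009, Def. 2.18 / §2.6.2; Sipser, §9.1 (EXPTIME)] [cite: AroraBarak2009, Def. 2.18 / §2.6.2] -/
noncomputable def EXP : Set (Language Bool) :=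
  ⋃ k : ℕ, DTIME (fun n => 2 ^ (n ^ k))

/-- The class `SUBEXP = ⋂_{ε>0} DTIME(2^{n^ε})` of languages decidable in subexponential time.
The intersection over real `ε > 0` is realised over `ε = 1/k` for `k : ℕ`, `0 < k` (a cofinal
family, so the intersection is the same by monotonicity of `DTIME`); the bound is
`2 ^ ⌈n ^ (1/k)⌉₊` with `Real.rpow` and `Nat.ceil`.
[Arora–Barak 2009, §20.1 (SUBEXP in derandomization); Impagliazzo–Wigderson 1997] [cite: AroraBarak2009, §20.1 (SUBEXP in derandomization] -/
noncomputable def SUBEXP : Set (Language Bool) :=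
  ⋂ (k : ℕ) (_ : 0 < k), DTIME (fun n => 2 ^ ⌈(n : ℝ) ^ (1 / (k : ℝ))⌉₊)

/-- `FTIME t`: string functions `{0,1}* → {0,1}*` computable in deterministic time `O(t n)`
(arithmetic form `c * t n + c`, encoders `id`). [Arora–Barak 2009, Def. 1.12 (adapted to
functions, cf. Def. 1.4)] [cite: AroraBarak2009, Def. 1.12 (adapted to functions  cf. Def] -/
def FTIME (t : ℕ → ℕ) : Set (List Bool → List Bool) :=
  {f | ∃ c : ℕ, TimeComputable id id f (fun n => c * t n + c)}

/-- The class `FP` of string functions computable in deterministic polynomial time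
(`PolyTimeComputable id id f`). [Arora–Barak 2009, Def. 1.12–1.13 and §17.2 (FP)] [cite: AroraBarak2009, Def. 1.12–1.13 and §17.2 (FP] -/
def FP : Set (List Bool → List Bool) :=
  {f | PolyTimeComputable id id f}

/-! ### Class operators -/

/-- The complement operator on classes: `co C = {L | Lᶜ ∈ C}` (so `coNP = co NP`).
[Arora–Barak 2009, Def. 2.19–2.20 (coNP, "for every class C, coC")] [cite: AroraBarak2009, Def. 2.19–2.20 (coNP  "for every class C] -/
def co (C : Set (Language Bool)) : Set (Language Bool) :=
  {L | Lᶜ ∈ C}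

/-- The infinitely-often operator: `L ∈ io C` iff some `L' ∈ C` agrees with `L` on all strings
of length `n` for infinitely many `n` (`∃ᶠ n in atTop`).
[Arora–Barak 2009, §20 (i.o. classes in derandomization); Impagliazzo–Wigderson 1997] [cite: AroraBarak2009, §20 (i.o. classes in derandomization] -/
def io (C : Set (Language Bool)) : Set (Language Bool) :=
  {L | ∃ L' ∈ C, ∃ᶠ n in atTop, ∀ x : List Bool, x.length = n → (x ∈ L ↔ x ∈ L')}

/-! ### Time-constructible functions -/

/-- `IsTimeConstructible t`: `t n ≥ n` and the map `1ⁿ ↦ ⟨t n⟩₂` (unary input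
`unaryEncodeNat`, binary output `encodeNat`) is computable in time `O(t n)`.
This is Sipser's binary-output form; for `t n ≥ n` it is equivalent to producing the string
`1^{t(n)}` in `O(t(n))` steps (Arora–Barak's form), and it is implied by Hartmanis–Stearns
real-time countability. [Sipser, Def. 9.8; Arora–Barak 2009, §1.3 (time-constructible
functions); Hartmanis–Stearns 1965] [cite: AroraBarak2009, §1.3 (time-constructible functions] -/
def IsTimeConstructible (t : ℕ → ℕ) : Prop :=
  (∀ n, n ≤ t n) ∧ ∃ c : ℕ, TimeComputable unaryEncodeNat encodeNat t (fun n => c * t n + c)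

/-! ### API -/

/-- Monotonicity of the exact time class in the time bound. [Sipser, Def. 7.7] [folklore] -/
theorem timeClass_mono {t t' : ℕ → ℕ} (h : ∀ n, t n ≤ t' n) : TimeClass t ⊆ TimeClass t' :=
  fun _ hL => by
    obtain ⟨M, hM⟩ := hL
    exact ⟨M, hM.mono fun a => h _⟩

/-- Monotonicity of `DTIME` in the time bound. [Arora–Barak 2009, Def. 1.12] [cite: AroraBarak2009, Def. 1.12] -/
theorem DTIME_mono {t t' : ℕ → ℕ} (h : ∀ n, t n ≤ t' n) : DTIME t ⊆ DTIME t' := by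
  rintro L ⟨c, hc⟩
  exact ⟨c, timeClass_mono (fun n => by have := h n; nlinarith) hc⟩

/-- An exact time class embeds in `DTIME t` for any bound `t`-big-O-dominating it: if
`T = O(t)` at `atTop` (as real-valued functions) then `TimeClass T ⊆ DTIME t`. This records
the equivalence of the arithmetic form `c * t n + c` with Mathlib's `Asymptotics.IsBigO`
(finitely many exceptional `n` are absorbed into the additive constant, using that every
`L ∈ TimeClass T` has `T n ≥ n - O(1)` by the halting rule and that machines can be patched
on finitely many lengths). [Arora–Barak 2009, Def. 1.12; Sipser, Def. 7.7] [cite: AroraBarak2009, Def. 1.12] -/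
def mem_DTIME_of_isBigO : Prop :=
  ∀ {T t : ℕ → ℕ} (h : (fun n => (T n : ℝ)) =O[atTop] (fun n => (t n : ℝ))),
    TimeClass T ⊆ DTIME t

/-- Membership in `P` is polynomial-time decidability with respect to the identity encoding:
`L ∈ P ↔ PolyTimeDecidable id L` (every `Polynomial ℕ` is dominated by `c * n ^ k + c` and
conversely). [Arora–Barak 2009, Def. 1.13; Sipser, Def. 7.12] [cite: AroraBarak2009, Def. 1.13] -/
def mem_P_iff : Prop :=
  ∀ {L : Language Bool},
    L ∈ Classes.P ↔ PolyTimeDecidable id L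

/-- An exact polynomial time class is contained in `P`: `TimeClass (p.eval ·) ⊆ P` for every
`p : Polynomial ℕ` (Cook's literal `n ^ k + k` bounds). [Arora–Barak 2009, Def. 1.13] [cite: AroraBarak2009, Def. 1.13] -/
def timeClass_subset_P_of_polynomial : Prop :=
  ∀ (p : Polynomial ℕ),
    TimeClass (fun n => p.eval n) ⊆ Classes.P

/-- `P ⊆ EXP` (since `n ^ k ≤ 2 ^ (n ^ k)`). [Arora–Barak 2009, §2.6.2; Sipser, §9.1] [cite: AroraBarak2009, §2.6.2] -/
theorem P_subset_EXP : Classes.P ⊆ EXP := by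
  rintro L hL
  simp only [Classes.P, EXP, Set.mem_iUnion] at hL ⊢
  obtain ⟨k, hk⟩ := hL
  exact ⟨k, DTIME_mono (fun n => (Nat.lt_two_pow_self).le) hk⟩

/-- `co` is an involution: `co (co C) = C`. [Arora–Barak 2009, Def. 2.20] [cite: AroraBarak2009, Def. 2.20] -/
@[simp] theorem co_co (C : Set (Language Bool)) : co (co C) = C := by
  ext L
  simp [co]

/-- `co` is monotone. [Arora–Barak 2009, Def. 2.20] [cite: AroraBarak2009, Def. 2.20] -/
theorem co_mono {C D : Set (Language Bool)} (h : C ⊆ D) : co C ⊆ co D :=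
  fun _ hL => h hL

/-- `P` is closed under complement: `co P = P` (swap the output bit).
[Arora–Barak 2009, §2.6.1; Sipser, Ch. 7] [cite: AroraBarak2009, §2.6.1] -/
def co_P : Prop :=
  co Classes.P = Classes.P

/-! ### Discharges (D-0014: the facts above stay `def`s; users' `(h : X)` are fed `X_holds`) -/

section Discharges

open Polynomial

/-- Every polynomial with natural coefficients is dominated by a single power: for
`p : Polynomial ℕ` there are `c k : ℕ` with `p n ≤ c * n ^ k + c` for all `n` (take `k = deg p`,
`c` twice the coefficient sum; the `+ c` absorbs `n = 0`). This is the arithmetic content of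
"runs in time `c · n ^ k`, hence in `DTIME(n^k)`". [Arora–Barak 2009, Def. 1.12–1.13, p. 25]
[cite: AroraBarakCC2009, Def. 1.13] -/
theorem exists_eval_le_mul_pow_add (p : Polynomial ℕ) :
    ∃ c k : ℕ, ∀ n : ℕ, p.eval n ≤ c * n ^ k + c := by
  induction p using Polynomial.induction_on' with
  | add p q hp hq =>
    obtain ⟨c₁, k₁, h₁⟩ := hp
    obtain ⟨c₂, k₂, h₂⟩ := hq
    refine ⟨2 * (c₁ + c₂), max k₁ k₂, fun n => ?_⟩
    have hpow : ∀ i, i ≤ max k₁ k₂ → n ^ i ≤ n ^ max k₁ k₂ + 1 := by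
      intro i hi
      rcases Nat.eq_zero_or_pos n with rfl | hn
      · rcases Nat.eq_zero_or_pos i with rfl | hi0 <;> simp [*, Nat.pos_iff_ne_zero.mp]
      · exact (Nat.pow_le_pow_right hn hi).trans (Nat.le_add_right _ _)
    have e₁ := Nat.mul_le_mul_left c₁ (hpow k₁ (le_max_left _ _))
    have e₂ := Nat.mul_le_mul_left c₂ (hpow k₂ (le_max_right _ _))
    rw [eval_add]
    have := h₁ n
    have := h₂ n
    set N := n ^ max k₁ k₂
    nlinarith
  | monomial i a =>
    refine ⟨a, i, fun n => ?_⟩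
    simp [eval_monomial]

/-- Discharge of `mem_P_iff`: `L ∈ P ↔ PolyTimeDecidable id L`. (→) a bound `c * n ^ k + c` is
the polynomial `C c * X ^ k + C c`; (←) `exists_eval_le_mul_pow_add` and monotonicity of
`ComputesInTime` in the time bound. [Arora–Barak 2009, Def. 1.13 (P = ⋃_c DTIME(n^c)), p. 25;
Sipser, Def. 7.12] [cite: AroraBarakCC2009, Def. 1.13] -/
theorem mem_P_iff_holds : mem_P_iff := by
  intro L
  simp only [Classes.P, DTIME, TimeClass, Set.mem_iUnion, Set.mem_setOf_eq, PolyTimeDecidable]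
  constructor
  · rintro ⟨k, c, h⟩
    refine ⟨C c * X ^ k + C c, ?_⟩
    simpa using h
  · rintro ⟨p, h⟩
    obtain ⟨c, k, hck⟩ := exists_eval_le_mul_pow_add p
    obtain ⟨M, hM⟩ := h
    exact ⟨k, c, M, hM.mono fun a => hck _⟩

/-- Discharge of `timeClass_subset_P_of_polynomial`: an exact polynomial time class lies in `P`
(immediate from `mem_P_iff_holds`). [Arora–Barak 2009, Def. 1.13, p. 25]
[cite: AroraBarakCC2009, Def. 1.13] -/
theorem timeClass_subset_P_of_polynomial_holds : timeClass_subset_P_of_polynomial := by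
  intro p L hL
  exact mem_P_iff_holds.2 ⟨p, hL⟩

/-! #### Closure under complement: `co P = P`

The "flip the answer" relabelling of `TimeBoundsComplProofs`
(`Turing.TM2ComputableAux.OutputsWithin.outputAlphabet_trans`, used there for the polynomial
case `PolyTimeDecidable.compl_holds`), packaged as a machine `complMachine M` and run at an
*arbitrary* time bound: `TimeDecidable ea · t`, the exact classes `TimeClass t`, the classes
`DTIME t` and `P` are closed under complement, whence `co P = P`. -/

variable {α Γ₀ : Type}

/-- The *complement machine* of a deciding machine `M`: the same underlying `FinTM2` and the
same input-alphabet identification, with the output-alphabet identification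
`M.tm.Γ M.tm.k₁ ≃ Bool` post-composed with Boolean negation `Equiv.boolNot`. Its runs are
literally those of `M`; only the reading of the single answer symbol (`encodeBool b = [b]`) is
swapped — the formal content of "output `1 - M(x)`" for a deterministic machine.
[Arora–Barak 2009, §2.6.1 (coNP: "every language in P is in NP ∩ coNP"), Exercise 2.23
(`P ⊆ NP ∩ coNP`)] [cite: AroraBarakCC2009, §2.6.1 and Exercise 2.23] -/
def complMachine (M : Turing.TM2ComputableAux Γ₀ Bool) : Turing.TM2ComputableAux Γ₀ Bool :=
  ⟨M.tm, M.inputAlphabet, M.outputAlphabet.trans Equiv.boolNot⟩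

/-- `complMachine` keeps the underlying machine. [folklore] -/
theorem complMachine_tm (M : Turing.TM2ComputableAux Γ₀ Bool) : (complMachine M).tm = M.tm :=
  rfl

/-- `complMachine` keeps the input alphabet. [folklore] -/
theorem complMachine_inputAlphabet (M : Turing.TM2ComputableAux Γ₀ Bool) :
    (complMachine M).inputAlphabet = M.inputAlphabet :=
  rfl

/-- `complMachine` negates the output alphabet identification. [folklore] -/
theorem complMachine_outputAlphabet (M : Turing.TM2ComputableAux Γ₀ Bool) :
    (complMachine M).outputAlphabet = M.outputAlphabet.trans Equiv.boolNot :=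
  rfl

/-- If `M` decides `L` within `T`, then `complMachine M` decides `Lᶜ` within the *same* bound
`T` (no extra step: only the output identification changes; the run is transported by
`OutputsWithin.outputAlphabet_trans` and `encodeBool (Lᶜ.boolIndicator a) = [!L.boolIndicator a]`
by `boolIndicator_compl_apply`).
[Arora–Barak 2009, §2.6.1; Exercise 2.23] [cite: AroraBarakCC2009, §2.6.1 and Exercise 2.23] -/
protected theorem DecidesInTime.compl {ea : α → List Γ₀} {L : Set α} {T : α → ℕ}
    {M : Turing.TM2ComputableAux Γ₀ Bool} (h : DecidesInTime ea L T M) :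
    DecidesInTime ea Lᶜ T (complMachine M) := by
  intro a
  have key : encodeBool (Lᶜ.boolIndicator a) =
      (encodeBool (L.boolIndicator a)).map Equiv.boolNot := by
    show [_] = [_]
    rw [boolIndicator_compl_apply, Equiv.boolNot_apply]
  show (complMachine M).OutputsWithin (ea a) (encodeBool (Lᶜ.boolIndicator a)) (T a)
  rw [key]
  exact (h a).outputAlphabet_trans Equiv.boolNot

/-- `TimeDecidable` is closed under complement with the same time bound (`L` decidable in time
`t` ⟹ `Lᶜ` decidable in time `t`; Mathlib direction convention as in
`Language.IsRegular.compl`). [Arora–Barak 2009, §2.6.1; Exercise 2.23]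
[cite: AroraBarakCC2009, §2.6.1 and Exercise 2.23] -/
protected theorem TimeDecidable.compl {ea : α → List Γ₀} {L : Set α} {t : ℕ → ℕ}
    (h : TimeDecidable ea L t) : TimeDecidable ea Lᶜ t := by
  obtain ⟨M, hM⟩ := h
  exact ⟨complMachine M, hM.compl⟩

/-- Reverse direction: if `Lᶜ` is decidable in time `t` then so is `L` (as `Lᶜᶜ = L`;
Mathlib direction convention as in `Language.IsRegular.of_compl`).
[Arora–Barak 2009, §2.6.1; Exercise 2.23] [cite: AroraBarakCC2009, §2.6.1 and Exercise 2.23] -/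
theorem TimeDecidable.of_compl {ea : α → List Γ₀} {L : Set α} {t : ℕ → ℕ}
    (h : TimeDecidable ea Lᶜ t) : TimeDecidable ea L t := by
  simpa using h.compl

/-- `TimeDecidable ea Lᶜ t ↔ TimeDecidable ea L t`. [Arora–Barak 2009, §2.6.1; Exercise 2.23]
[cite: AroraBarakCC2009, §2.6.1 and Exercise 2.23] -/
@[simp] theorem timeDecidable_compl_iff {ea : α → List Γ₀} {L : Set α} {t : ℕ → ℕ} :
    TimeDecidable ea Lᶜ t ↔ TimeDecidable ea L t :=
  ⟨TimeDecidable.of_compl, TimeDecidable.compl⟩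

/-- Exact time classes are closed under complement: `Lᶜ ∈ TimeClass t ↔ L ∈ TimeClass t`.
[Arora–Barak 2009, §2.6.1; Exercise 2.23] [cite: AroraBarakCC2009, §2.6.1 and Exercise 2.23] -/
@[simp] theorem compl_mem_timeClass_iff {t : ℕ → ℕ} {L : Language Bool} :
    Lᶜ ∈ TimeClass t ↔ L ∈ TimeClass t :=
  timeDecidable_compl_iff

/-- `DTIME t` is closed under complement: `Lᶜ ∈ DTIME t ↔ L ∈ DTIME t`.
[Arora–Barak 2009, §2.6.1; Exercise 2.23] [cite: AroraBarakCC2009, §2.6.1 and Exercise 2.23] -/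
@[simp] theorem compl_mem_DTIME_iff {t : ℕ → ℕ} {L : Language Bool} :
    Lᶜ ∈ DTIME t ↔ L ∈ DTIME t := by
  simp [DTIME]

/-- `P` is closed under complement: `Lᶜ ∈ P ↔ L ∈ P` (equivalently, via `mem_P_iff_holds`,
`polyTimeDecidable_compl_iff` of `TimeBoundsComplProofs`).
[Arora–Barak 2009, §2.6.1; Exercise 2.23] [cite: AroraBarakCC2009, §2.6.1 and Exercise 2.23] -/
@[simp] theorem compl_mem_P_iff {L : Language Bool} : Lᶜ ∈ Classes.P ↔ L ∈ Classes.P := by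
  simp [Classes.P]

/-- `co C = C` as soon as membership in `C` is invariant under complement. [folklore] -/
theorem co_eq_self_of_compl_mem_iff {C : Set (Language Bool)} (h : ∀ L, Lᶜ ∈ C ↔ L ∈ C) :
    co C = C :=
  Set.ext fun L => h L

/-- Discharge of `co_P`: `co P = P`. Given a machine deciding `L` in time `c * n ^ k + c`,
`complMachine` decides `Lᶜ` in the same time, so `L ∈ P ↔ Lᶜ ∈ P`, i.e. `co P = P`
("P is closed under complementation"; every `L ∈ P` lies in `NP ∩ coNP`).
[Arora–Barak 2009, §2.6.1 (coNP: "every language in P is in NP ∩ coNP"), Exercise 2.23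
(`P ⊆ NP ∩ coNP`); Sipser, Ch. 7]
[cite: AroraBarakCC2009, §2.6.1 and Exercise 2.23] -/
theorem co_P_holds : co_P :=
  co_eq_self_of_compl_mem_iff fun _ => compl_mem_P_iff

end Discharges

end Literature.Computability.Complexity
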